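import Summits.CriticalPhenomena.PercolationContinuityZ3.Theorems.PercNearOneGluingNoHeavyLowerTailSahiCombSymmetry

/-!
# The comb (tensor-Bernstein) hierarchy for Sahi's `E_k`, VI: the ORDER-2 TOP laws and the elementary induction
# ORDER-2-TOP(3) ⟹ the top half of ORDER-1(3) (`c_3 ≤ c_2` on every coefficient line)

Support file of the one-cut programme (crux `NoHeavyLowerTail`, stmt-CriticalPhenomena-4575; cell `prim-bnk`, seat bnk-2 gen 6,
memo `run/shared/lean/prim/prim-l12/FROM-prim-bnk-2-g6-COMB-SHAPE-GRAPHS.md`; INEQ-CLAIMS rows COMB-M-E3, COMB-UNI/ENDMIN, S2-GRAPH).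

Write `c(s,t)` for the `3`-copy comb coefficient (`SahiComb.combCoeff`, file `…SahiCombCopyKernel`) of a triple of increasing
events at a profile whose digits at two distinct axes `e`, `f` are set to `s`, `t` (`combBlock`).  The four **mixed second
differences** of the `4 × 4` block are `Δ⁺_eΔ⁺_f c = c(2,2) − c(3,2) − c(2,3) + c(3,3)`, `Δ⁺_eΔ⁻_f c = c(2,1) − c(3,1) − c(2,0) + c(3,0)`
(and the two with `Δ⁻_e`), where `Δ⁺ := (t = 2) − (t = 3)` is the TOP-end drop and `Δ⁻ := (t = 1) − (t = 0)` the bottom-end rise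
of a line.  The census of the memo (exact integer engines, two independent implementations; generic cubes `m ≤ 4` exhaustive by
prim-ineq-gen-4 g5 §III; the three-copy arrays of all 99 essential 4-point graph-separation orbits on `K_5` (all 45 axis pairs,
`1.1·10⁸` non-zero blocks) and of the seven open decreasing orbits + the increasing star + γ on `K_6` (all 110 axis pairs of two
edge orders, `1.36·10¹⁰` non-zero blocks, kit j103474)) finds `Δ⁺Δ⁺ ≥ 0` and `Δ⁺Δ⁻ ≥ 0` WITHOUT exception and `Δ⁻Δ⁻ < 0`
already on `K_4`:
the top-end drop `Δ⁺_e c` is itself ORDER-1 in both directions along every other axis.  That is the conjecture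
`CombOrderTwoTop` below (an obligation of our theories, never a fact; OPEN).

What is PROVED here (std axioms): **`CombOrderTwoTop 3` implies `c_3 ≤ c_2` on every coefficient line of every triple of
increasing events on every finite cube with at least two points** (`combLine_three_top_le_of_orderTwoTop`), by induction on a
determining coordinate set: through a second axis `f` the top inequality at `f`-digit `1` (resp. `2`) is the one at `f`-digit `0`
(resp. `3`) — a line of the `f`-section, induction — plus `Δ⁺_eΔ⁻_f c ≥ 0` (resp. `Δ⁺_eΔ⁺_f c ≥ 0`); and when the triple depends on
`e` alone, `Δ⁺_eΔ⁺_f c = 2·(c(2,0) − c(3,0))` for an ignored `f` (binomial lines, `combCoeff_update_of_ignores`) gives the base.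
With prim-ineq-gen-4's log-derivative schema (`…LogDerivSchema`: `3β₂ ≥ β₃` at every parameter ⟹ `E_3(p) ≥ p_e²·E_3` of the
`1`-section) the top half of ORDER-1 alone already yields Sahi's `C_3` on product measures by induction on the coordinates (series
reparametrisation, prim-ineq-gen-4 g5 §II — that measure-level link is NOT formalised in this file), so ORDER-2-TOP(3) is a
two-dimensional, self-similar sufficient condition for every open `E_3` row of the programme. [this work]
-/

noncomputable section

open scoped Classical

namespace Summit.CriticalPhenomena.PercolationContinuityZ3.Theorems

open Finset Function
open Literature.Probability.Percolation (DeterminedBy determinedBy_iff)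
open Literature.Probability.Percolation.DecisionTree (ind ind_of_mem ind_of_not_mem ind_nonneg)
open Literature.Probability.LatticeModels (isUpperSet_preimage_compl)
open SahiComb

section OrderTwo

/-- **An entry of the `(e,f)`-block** through the profile `j`: the `k`-copy comb coefficient of `(1_{U_i})` at the profile
`j[e ↦ s][f ↦ t]`. [this work] -/
def combBlock {ι : Type*} [Fintype ι] (k : ℕ) (U : Fin k → Set (Set ι)) (e f : ι) (j : ι → ℕ) (s t : ℕ) : ℝ :=
  combCoeff k (fun i => ind (U i)) (update (update j e s) f t)

/-- **COMB-ORDER-2-TOP(k)** (bnk-2 gen 6, INEQ-CLAIMS row S2-GRAPH; for `k = 3` the patterns `(0−,2+)` and `(1−,1+)` of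
prim-ineq-gen-4 g5 §III): for `k ≥ 2`, every `k`-tuple of increasing events on a finite cube, all axes `e ≠ f` and every
profile, the two mixed second differences of the comb array with a TOP-end drop at `e` are `≥ 0`:
`Δ⁺_eΔ⁺_f c = c(k−1,k−1) − c(k,k−1) − c(k−1,k) + c(k,k) ≥ 0` and `Δ⁺_eΔ⁻_f c = c(k−1,1) − c(k,1) − c(k−1,0) + c(k,0) ≥ 0`.
Census (`k = 3`, exact, two engines): generic cubes `m ≤ 4` exhaustive (804 440 triples) + `m = 5, 6` random, `0` violations;
three-copy arrays of all 99 essential 4-point graph-separation orbits on `K_4` (exhaustive cross-check of two engines) and `K_5` (all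
45 axis pairs, `1.1·10⁸` non-zero blocks), and of the 7 open decreasing orbits + increasing star + γ on `K_6` (110 axis pairs,
`1.36·10¹⁰` non-zero blocks): `0` violations; the companion `Δ⁻_eΔ⁻_f c ≥ 0` is FALSE (`K_4`; `2·10⁴` blocks on `K_6`).  Implies the top half of
ORDER-1(3) (`combLine_three_top_le_of_orderTwoTop`).  OPEN; an obligation of our theories, never a fact.
[this work] [status: open for k ≥ 3] -/
@[conjecture] def CombOrderTwoTop (k : ℕ) : Prop :=
  2 ≤ k → ∀ (ι : Type) [Fintype ι] (U : Fin k → Set (Set ι)), (∀ i, IsUpperSet (U i)) →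
    ∀ (e f : ι), e ≠ f → ∀ j : ι → ℕ,
      0 ≤ combBlock k U e f j (k - 1) (k - 1) - combBlock k U e f j k (k - 1) - combBlock k U e f j (k - 1) k
            + combBlock k U e f j k k ∧
      0 ≤ combBlock k U e f j (k - 1) 1 - combBlock k U e f j k 1 - combBlock k U e f j (k - 1) 0 + combBlock k U e f j k 0

variable {ι : Type} [Fintype ι]

omit [Fintype ι] in
/-- An event determined by a set not containing `f` has an indicator that ignores `f`. [folklore] -/
theorem ind_insert_of_determinedBy_notMem {A : Set (Set ι)} {S : Finset ι} (hA : DeterminedBy A (↑S : Set ι)) {f : ι}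
    (hf : f ∉ S) (ω : Set ι) : ind A (insert f ω) = ind A ω := by
  rw [determinedBy_iff] at hA
  have h : insert f ω ∈ A ↔ ω ∈ A := hA _ _ (by
    ext x
    simp only [Set.mem_inter_iff, Set.mem_insert_iff, Finset.mem_coe]
    constructor
    · rintro ⟨hx | hx, hxS⟩
      · exact absurd (hx ▸ hxS) hf
      · exact ⟨hx, hxS⟩
    · rintro ⟨hx, hxS⟩
      exact ⟨Or.inr hx, hxS⟩)
  by_cases hω : ω ∈ A
  · rw [ind_of_mem hω, ind_of_mem (h.2 hω)]
  · rw [ind_of_not_mem hω, ind_of_not_mem fun h' => hω (h.1 h')]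

/-- Profiles with a digit above `3` carry the zero coefficient (outside the box). [this work] -/
theorem combLine_three_eq_zero_of_lt (U : Fin 3 → Set (Set ι)) (e : ι) (j : ι → ℕ) {x : ι} (hxe : x ≠ e)
    (hx : 3 < j x) (s : ℕ) : combLine 3 U e j s = 0 := by
  unfold combLine
  refine combCoeff_eq_zero_of_not_mem_box _ fun hj => ?_
  have h := (mem_box.1 hj) x
  rw [update_of_ne hxe] at h
  exact absurd h (not_le.2 hx)

/-- **The induction** (one cube, hypotheses = the two ORDER-2-TOP laws on that cube): for every triple of increasing events
determined by `S`, every axis `e`, every second point `f ≠ e` and every profile, `c_3 ≤ c_2` on the line along `e`.  Strong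
induction on `S`: peel any determining coordinate `x ≠ e` (faces = sections, `Δ⁺_eΔ⁻_x`, `Δ⁺_eΔ⁺_x`), and when the triple is
determined by `{e}` read `Δ⁺_eΔ⁺_f c = 2(c(2,0) − c(3,0))` off the binomial `f`-lines. [this work] -/
theorem SahiComb.combLine_three_top_le_aux
    (hPP : ∀ (U : Fin 3 → Set (Set ι)), (∀ i, IsUpperSet (U i)) → ∀ (e f : ι), e ≠ f → ∀ j : ι → ℕ,
      0 ≤ combBlock 3 U e f j 2 2 - combBlock 3 U e f j 3 2 - combBlock 3 U e f j 2 3 + combBlock 3 U e f j 3 3)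
    (hPM : ∀ (U : Fin 3 → Set (Set ι)), (∀ i, IsUpperSet (U i)) → ∀ (e f : ι), e ≠ f → ∀ j : ι → ℕ,
      0 ≤ combBlock 3 U e f j 2 1 - combBlock 3 U e f j 3 1 - combBlock 3 U e f j 2 0 + combBlock 3 U e f j 3 0)
    (S : Finset ι) :
    ∀ (U : Fin 3 → Set (Set ι)), (∀ i, IsUpperSet (U i)) → (∀ i, DeterminedBy (U i) (↑S : Set ι)) →
      ∀ (e f : ι), e ≠ f → ∀ j : ι → ℕ, combLine 3 U e j 3 ≤ combLine 3 U e j 2 := by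
  induction S using Finset.strongInduction with
  | H S ih =>
  intro U hU hUd e f hef j
  by_cases hx : ∃ x ∈ S, x ≠ e
  · -- peel a determining coordinate `x ≠ e`
    obtain ⟨x, hxS, hxe⟩ := hx
    have hsub : S.erase x ⊂ S := erase_ssubset hxS
    have hsec : ∀ (b : Bool), (∀ i, IsUpperSet (secAt x b (U i))) ∧
        ∀ i, DeterminedBy (secAt x b (U i)) (↑(S.erase x) : Set ι) :=
      fun b => ⟨fun i => isUpperSet_secAt x b (hU i), fun i => determinedBy_secAt x b (hUd i)⟩
    -- the face values: lines of the sections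
    have hface0 : ∀ s, combBlock 3 U e x j s 0 = combLine 3 (fun i => secAt x false (U i)) e (update j x 0) s := by
      intro s
      unfold combBlock combLine
      rw [combCoeff_ind_eq_secAt_false U x (update_self x 0 _), update_comm hxe]
    have hface3 : ∀ s, combBlock 3 U e x j s 3 = combLine 3 (fun i => secAt x true (U i)) e (update j x 3) s := by
      intro s
      unfold combBlock combLine
      rw [combCoeff_ind_eq_secAt_true U x (update_self x 3 _), update_comm hxe]
    have ih0 : combBlock 3 U e x j 3 0 ≤ combBlock 3 U e x j 2 0 := by
      rw [hface0, hface0]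
      exact ih _ hsub _ (hsec false).1 (hsec false).2 e f hef _
    have ih3 : combBlock 3 U e x j 3 3 ≤ combBlock 3 U e x j 2 3 := by
      rw [hface3, hface3]
      exact ih _ hsub _ (hsec true).1 (hsec true).2 e f hef _
    -- the line along `e` sits at `x`-digit `t := j x` of the `(e,x)`-block
    have hline : ∀ s, combLine 3 U e j s = combBlock 3 U e x j s (j x) := by
      intro s
      unfold combBlock combLine
      congr 1
      rw [eq_comm, update_eq_self_iff, update_of_ne hxe]
    rcases Nat.lt_or_ge 3 (j x) with hbig | hle
    · rw [combLine_three_eq_zero_of_lt U e j hxe hbig, combLine_three_eq_zero_of_lt U e j hxe hbig]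
    · rw [hline, hline]
      interval_cases hjx : j x
      · exact ih0
      · have h := hPM U hU e x hxe.symm j
        linarith
      · have h := hPP U hU e x hxe.symm j
        linarith
      · exact ih3
  · -- the triple is determined by `{e}`: every `U i` ignores `f`
    push Not at hx
    have hfS : f ∉ S := fun hfS => hef (hx f hfS).symm
    have hign : ∀ (i : Fin 3) (ω : Set ι), ind (U i) (insert f ω) = ind (U i) ω :=
      fun i ω => ind_insert_of_determinedBy_notMem (hUd i) hfS ω
    -- binomial `f`-lines: block entries in terms of the `f`-digit-`0` column
    have hcol : ∀ s t, combBlock 3 U e f j s t = ((3 : ℕ).choose t : ℝ) * combBlock 3 U e f j s 0 := by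
      intro s t
      unfold combBlock
      exact combCoeff_update_of_ignores hign _ t
    have hA : combBlock 3 U e f j 3 0 ≤ combBlock 3 U e f j 2 0 := by
      have h := hPP U hU e f hef j
      rw [hcol 2 2, hcol 3 2, hcol 2 3, hcol 3 3] at h
      norm_num [Nat.choose] at h
      linarith
    have hline : ∀ s, combLine 3 U e j s = combBlock 3 U e f j s (j f) := by
      intro s
      unfold combBlock combLine
      congr 1
      rw [eq_comm, update_eq_self_iff, update_of_ne hef.symm]
    rw [hline, hline, hcol 3, hcol 2]
    exact mul_le_mul_of_nonneg_left hA (Nat.cast_nonneg _)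

/-- **ORDER-2-TOP(3) ⟹ the top half of ORDER-1(3)**: if the two mixed second differences with a top-end drop are `≥ 0` for
all triples of increasing events on all finite cubes, then `c_3 ≤ c_2` on every coefficient line of every such triple (on every
cube with a second point `f ≠ e`; on a one-point cube the statement is the four-number check `(0,2,1,0)`, `(0,1,1,0)`, `0`,
not needed downstream).  With prim-ineq-gen-4's log-derivative schema (series reparametrisation + `…LogDerivSchema`; not
formalised here) this half alone gives Sahi's `C_3` for product measures by induction on the coordinates; so `CombOrderTwoTop 3`
is a sufficient condition for every open `E_3` row. [this work] -/
theorem combLine_three_top_le_of_orderTwoTop (h : CombOrderTwoTop 3) (U : Fin 3 → Set (Set ι))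
    (hU : ∀ i, IsUpperSet (U i)) (e f : ι) (hef : e ≠ f) (j : ι → ℕ) :
    combLine 3 U e j 3 ≤ combLine 3 U e j 2 :=
  combLine_three_top_le_aux (fun U hU e f hef j => (h (by norm_num) ι U hU e f hef j).1)
    (fun U hU e f hef j => (h (by norm_num) ι U hU e f hef j).2) Finset.univ U hU
    (fun i => determinedBy_coe_univ (U i)) e f hef j

/-- **Decreasing triples** (the 45 dec graph-separation orbits are down-set triples): under `CombOrderTwoTop 3` the BOTTOM
inequality `c_0 ≤ c_1` holds on every line of every triple of decreasing events (reflection `t ↦ 3 − t`, `…SahiCombSymmetry`). [this work] -/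
theorem combLine_three_bottom_le_lower_of_orderTwoTop (h : CombOrderTwoTop 3) (D : Fin 3 → Set (Set ι))
    (hD : ∀ i, IsLowerSet (D i)) (e f : ι) (hef : e ≠ f) (j : ι → ℕ) :
    combLine 3 D e j 0 ≤ combLine 3 D e j 1 := by
  by_cases hj : update j e 0 ∈ box (fun _ : ι => 3)
  · rw [combLine_lower_eq D e j hj (Nat.zero_le 3), combLine_lower_eq D e j hj (by norm_num : 1 ≤ 3)]
    exact combLine_three_top_le_of_orderTwoTop h _ (fun i => isUpperSet_preimage_compl (hD i)) e f hef _
  · rw [combLine_eq_zero_of_not_mem_box D e hj, combLine_eq_zero_of_not_mem_box D e hj]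

end OrderTwo

end Summit.CriticalPhenomena.PercolationContinuityZ3.Theorems
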